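import Summits.PneNP.PneNP.Theorems.SymmetryBudgetNoHiddenOrderBranchSumHub

/-!
# log-BranchSum: along a refinement path the branching numbers have `Σ ⌊log₂ d_k⌋ ≤ 4|V| + ⌊log₂|V|⌋`

Route `PneNP/SymmetryBudget`, item `NoHiddenOrder` (stmt-PneNP-14781); memo ANALYSIS-4 §8 (Theorem G).
Setting: seat 2's abstraction `BranchSum.RefinementPath` of a root–leaf path of the Corneil–Goldberg
recursion tree (hypotheses H1–H5, `SymmetryBudgetNoHiddenOrderBranchSumDefs.lean`), whose Theorem 9.1
(`sum_d_le`) bounds `Σ d_k` by `6·|V|·log|V|`.  For the certified per-path labels of ANALYSIS-4 only the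
LOGARITHMIC sum matters (the disorder of a label is `≤ t + 2 Σ log₂ d_k`), and that sum is LINEAR:

* `exists_halved_survivor` — at every transition `k → k+1` with `W (k+1) ≠ ∅` some surviving vertex has
  its cell at least halved (H3 cut at `S = W (k+1)` + seat 2's `not_swAdj_of_removed`);
* the potential `Phi k = Σ_{cells C of node k} ⌊log₂ |C|⌋ ≤ |W k|` and the per-cell inequality
  `⌊log₂|C|⌋ ≤ Σ_{cells D ⊆ C of node k+1} ⌊log₂|D|⌋ + (#vertices of C removed)` (`log_fib_le`), improved by
  `⌊log₂ d_{k+1}⌋ - 1` on a cell containing two cells of node `k+1` (`log_fib_le_of_two`);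
* the dichotomy FAT (the halved survivor's old cell contains a second new cell) / HEAVY (it does not, and
  then at least `d_{k+1}` vertices are removed), whence the transition inequality
  `⌊log₂ d_{k+1}⌋ + Phi k ≤ Phi (k+1) + 2·(|W k| - |W (k+1)|) + 1` (`log_d_succ_le`);
* telescoping: **`sum_log_d_le`**: `Σ_{k<N} ⌊log₂ d_k⌋ ≤ 4·|V| + ⌊log₂ |V|⌋`.

Consequence (memo, not formalised here): per-path `Σ log₂ d ≤ 5g + log₂ g`, so the Corneil–Goldberg tree on
a `g`-vertex coloured graph has `≤ 2^{5g + log₂ g}` leaves and the certified label scheme is complete with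
`2^{O(g)}` labels — `NoHiddenOrder` modulo the compilation technology.  Supports stmt-PneNP-14781.
-/

-- `Summit.PneNP.PneNP.…` duplicates `PneNP` BY DESIGN (single-problem summit, D-0017 layout).
set_option linter.dupNamespace false

namespace Summit.PneNP.PneNP.Theorems

open Finset

namespace BranchSum

/-! ### Integer logarithm inequalities -/

/-- `⌊log₂ (m · 2^r)⌋ = ⌊log₂ m⌋ + r` for `m ≠ 0`. -/
theorem log_mul_two_pow {m : ℕ} (hm : m ≠ 0) (r : ℕ) : Nat.log 2 (m * 2 ^ r) = Nat.log 2 m + r := by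
  induction r with
  | zero => simp
  | succ r ih =>
    rw [pow_succ, ← mul_assoc, Nat.log_mul_base (by norm_num) (by positivity), ih, Nat.add_assoc]

/-- Removing `r` elements costs at most `r`: `⌊log₂ (m + r)⌋ ≤ ⌊log₂ m⌋ + r` for `m ≠ 0`. -/
theorem log_add_le {m : ℕ} (hm : m ≠ 0) (r : ℕ) : Nat.log 2 (m + r) ≤ Nat.log 2 m + r := by
  rw [← log_mul_two_pow hm r]
  apply Nat.log_mono_right
  have h1 : r < 2 ^ r := Nat.lt_two_pow_self
  have h2 : 1 ≤ m := Nat.one_le_iff_ne_zero.2 hm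
  nlinarith

/-- Superadditivity for two pieces of size `≥ 2`: `⌊log₂ (a + b)⌋ ≤ ⌊log₂ a⌋ + ⌊log₂ b⌋`. -/
theorem log_add_le_add_log {a b : ℕ} (ha : 2 ≤ a) (hb : 2 ≤ b) :
    Nat.log 2 (a + b) ≤ Nat.log 2 a + Nat.log 2 b := by
  wlog hab : a ≤ b generalizing a b
  · rw [Nat.add_comm a b, Nat.add_comm (Nat.log 2 a)]
    exact this hb ha (le_of_not_ge hab)
  have h1 : Nat.log 2 (a + b) ≤ Nat.log 2 (b * 2) :=
    Nat.log_mono_right (by omega)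
  rw [Nat.log_mul_base (by norm_num) (by omega)] at h1
  have h2 : 1 ≤ Nat.log 2 a := Nat.le_log_of_pow_le (by norm_num) (by simpa using ha)
  omega

/-- Half of `m` has logarithm at least `⌊log₂ m⌋ - 1`: if `m ≤ 2 x` then `⌊log₂ m⌋ ≤ ⌊log₂ x⌋ + 1`. -/
theorem log_le_log_half_succ {m x : ℕ} (hx : x ≠ 0) (h : m ≤ 2 * x) : Nat.log 2 m ≤ Nat.log 2 x + 1 := by
  calc Nat.log 2 m ≤ Nat.log 2 (x * 2) := Nat.log_mono_right (by omega)
    _ = Nat.log 2 x + 1 := Nat.log_mul_base (by norm_num) hx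

/-- Superadditivity over a nonempty family of numbers `≥ 2`. -/
theorem log_sum_le_sum_log {ι : Type*} (s : Finset ι) (f : ι → ℕ) (hs : s.Nonempty)
    (hf : ∀ i ∈ s, 2 ≤ f i) : Nat.log 2 (∑ i ∈ s, f i) ≤ ∑ i ∈ s, Nat.log 2 (f i) := by
  classical
  induction s using Finset.induction_on with
  | empty => exact absurd hs (by simp)
  | insert a s has ih =>
    rw [sum_insert has, sum_insert has]
    rcases s.eq_empty_or_nonempty with hse | hsne
    · subst hse; simp
    · have hfa : 2 ≤ f a := hf a (mem_insert_self a s)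
      have hfs : ∀ i ∈ s, 2 ≤ f i := fun i hi => hf i (mem_insert_of_mem hi)
      have h2 : 2 ≤ ∑ i ∈ s, f i := by
        obtain ⟨b, hb⟩ := hsne
        exact (hfs b hb).trans (single_le_sum (fun i _ => Nat.zero_le _) hb)
      calc Nat.log 2 (f a + ∑ i ∈ s, f i) ≤ Nat.log 2 (f a) + Nat.log 2 (∑ i ∈ s, f i) :=
            log_add_le_add_log hfa h2
        _ ≤ Nat.log 2 (f a) + ∑ i ∈ s, Nat.log 2 (f i) := Nat.add_le_add_left (ih hsne hfs) _

variable {V : Type*} [DecidableEq V] {G : SimpleGraph V} [DecidableRel G.Adj] {N : ℕ}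

namespace RefinementPath

variable (R : RefinementPath G N)

/-! ### Colours, fibres, the potential -/

/-- The colours present at node `k`. -/
def colours (k : ℕ) : Finset ℕ := (R.W k).image (R.col k)

/-- The fibre (cell) of colour `c` at node `k`. -/
def fib (k : ℕ) (c : ℕ) : Finset V := (R.W k).filter fun v => R.col k v = c

/-- The part of the fibre of colour `c` of node `k` that survives to node `k+1`. -/
def surv (k : ℕ) (c : ℕ) : Finset V := (R.W (k + 1)).filter fun v => R.col k v = c

/-- The node-`k+1` colours inside the fibre of colour `c` of node `k`. -/
def sub (k : ℕ) (c : ℕ) : Finset ℕ := (R.surv k c).image (R.col (k + 1))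

/-- THE POTENTIAL `Φ_k = Σ_{cells C of node k} ⌊log₂ |C|⌋`. -/
def Phi (k : ℕ) : ℕ := ∑ c ∈ R.colours k, Nat.log 2 (R.fib k c).card

/-- The cell of `u` is the fibre of its colour. -/
theorem cell_eq_fib (k : ℕ) (u : V) : R.cell k u = R.fib k (R.col k u) := rfl

/-- Fibres of present colours are nonempty. -/
theorem fib_nonempty {k c : ℕ} (hc : c ∈ R.colours k) : (R.fib k c).Nonempty := by
  obtain ⟨u, hu, rfl⟩ := mem_image.1 hc
  exact ⟨u, mem_filter.2 ⟨hu, rfl⟩⟩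

/-- Fibres of present colours have at least two elements. -/
theorem two_le_card_fib {k c : ℕ} (hc : c ∈ R.colours k) : 2 ≤ (R.fib k c).card := by
  obtain ⟨u, hu, rfl⟩ := mem_image.1 hc
  exact R.two_le k u hu

/-- The fibres partition `W k`. -/
theorem sum_card_fib (k : ℕ) : ∑ c ∈ R.colours k, (R.fib k c).card = (R.W k).card :=
  (card_eq_sum_card_fiberwise fun _ hv => mem_image_of_mem _ hv).symm

/-- The surviving parts partition `W (k+1)`. -/
theorem sum_card_surv (k : ℕ) : ∑ c ∈ R.colours k, (R.surv k c).card = (R.W (k + 1)).card :=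
  (card_eq_sum_card_fiberwise fun _ hv => mem_image_of_mem _ (R.nest k hv)).symm

/-- The surviving part lies in the fibre. -/
theorem surv_subset_fib (k c : ℕ) : R.surv k c ⊆ R.fib k c := fun v hv => by
  rw [surv, mem_filter] at hv
  exact mem_filter.2 ⟨R.nest k hv.1, hv.2⟩

/-- A node-`k+1` fibre of a colour inside `c` is exactly the corresponding slice of the surviving part. -/
theorem fib_succ_eq_filter {k c c' : ℕ} (hc' : c' ∈ R.sub k c) :
    R.fib (k + 1) c' = (R.surv k c).filter fun v => R.col (k + 1) v = c' := by
  obtain ⟨u, hu, rfl⟩ := mem_image.1 hc'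
  rw [surv, mem_filter] at hu
  ext v
  simp only [fib, surv, mem_filter]
  constructor
  · rintro ⟨hv, hcol⟩
    exact ⟨⟨hv, (R.colNest k v hv u hu.1 hcol).trans hu.2⟩, hcol⟩
  · rintro ⟨⟨hv, -⟩, hcol⟩
    exact ⟨hv, hcol⟩

/-- The surviving part is partitioned by the node-`k+1` fibres inside it. -/
theorem sum_card_fib_succ (k c : ℕ) : ∑ c' ∈ R.sub k c, (R.fib (k + 1) c').card = (R.surv k c).card := by
  rw [card_eq_sum_card_fiberwise (f := R.col (k + 1)) (t := R.sub k c) fun v hv => mem_image_of_mem _ hv]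
  exact sum_congr rfl fun c' hc' => by rw [R.fib_succ_eq_filter hc']

/-- Node-`k+1` fibres inside `c` have at least two elements. -/
theorem two_le_card_fib_succ {k c c' : ℕ} (hc' : c' ∈ R.sub k c) : 2 ≤ (R.fib (k + 1) c').card := by
  obtain ⟨u, hu, rfl⟩ := mem_image.1 hc'
  rw [surv, mem_filter] at hu
  exact R.two_le (k + 1) u hu.1

/-- The colours of node `k+1` are the disjoint union over the colours `c` of node `k` of `sub k c`. -/
theorem colours_succ_eq_biUnion (k : ℕ) : R.colours (k + 1) = (R.colours k).biUnion (R.sub k) := by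
  ext c'
  simp only [colours, sub, surv, mem_biUnion, mem_image, mem_filter]
  constructor
  · rintro ⟨v, hv, rfl⟩
    exact ⟨R.col k v, ⟨v, R.nest k hv, rfl⟩, v, ⟨hv, rfl⟩, rfl⟩
  · rintro ⟨c, -, v, ⟨hv, -⟩, rfl⟩
    exact ⟨v, hv, rfl⟩

/-- The families `sub k c` are pairwise disjoint. -/
theorem pairwiseDisjoint_sub (k : ℕ) : ((R.colours k) : Set ℕ).PairwiseDisjoint (R.sub k) := by
  intro c _ c₂ _ hne
  refine disjoint_left.2 fun c' h1 h2 => hne ?_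
  obtain ⟨u, hu, huc⟩ := mem_image.1 h1
  obtain ⟨v, hv, hvc⟩ := mem_image.1 h2
  rw [surv, mem_filter] at hu hv
  rw [← hu.2, ← hv.2]
  exact R.colNest k u hu.1 v hv.1 (huc.trans hvc.symm)

/-- The potential of node `k+1`, grouped by the cells of node `k`. -/
theorem Phi_succ_eq (k : ℕ) :
    R.Phi (k + 1) = ∑ c ∈ R.colours k, ∑ c' ∈ R.sub k c, Nat.log 2 (R.fib (k + 1) c').card := by
  rw [Phi, R.colours_succ_eq_biUnion k, sum_biUnion (R.pairwiseDisjoint_sub k)]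

/-- The potential is at most the number of vertices. -/
theorem Phi_le_card (k : ℕ) : R.Phi k ≤ (R.W k).card := by
  rw [Phi, ← R.sum_card_fib k]
  exact sum_le_sum fun c hc => (Nat.log_lt_self 2 (card_pos.2 (R.fib_nonempty hc)).ne').le

/-! ### The per-cell inequalities -/

/-- Colours of vertices of `W k` are present. -/
theorem col_mem_colours {k : ℕ} {u : V} (hu : u ∈ R.W k) : R.col k u ∈ R.colours k :=
  mem_image_of_mem _ hu

/-- A survivor lies in the surviving part of its old colour, and its new colour is a sub-colour. -/
theorem col_succ_mem_sub {k : ℕ} {u : V} (hu : u ∈ R.W (k + 1)) : R.col (k + 1) u ∈ R.sub k (R.col k u) :=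
  mem_image_of_mem _ (mem_filter.2 ⟨hu, rfl⟩)

/-- **Per-cell inequality.** `⌊log₂|C|⌋ ≤ Σ_{cells D ⊆ C of node k+1} ⌊log₂|D|⌋ + #(removed vertices of C)`. -/
theorem log_fib_le {k c : ℕ} (hc : c ∈ R.colours k) :
    Nat.log 2 (R.fib k c).card ≤
      ∑ c' ∈ R.sub k c, Nat.log 2 (R.fib (k + 1) c').card + ((R.fib k c).card - (R.surv k c).card) := by
  have hsub : (R.surv k c).card ≤ (R.fib k c).card := card_le_card (R.surv_subset_fib k c)
  rcases (R.surv k c).eq_empty_or_nonempty with h0 | hne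
  · have hsub0 : R.sub k c = ∅ := by rw [sub, h0, image_empty]
    rw [hsub0, sum_empty, h0, card_empty, Nat.sub_zero, Nat.zero_add]
    exact (Nat.log_lt_self 2 (card_pos.2 (R.fib_nonempty hc)).ne').le
  · have hsubne : (R.sub k c).Nonempty := hne.image _
    have h1 : Nat.log 2 (R.surv k c).card ≤ ∑ c' ∈ R.sub k c, Nat.log 2 (R.fib (k + 1) c').card := by
      rw [← R.sum_card_fib_succ k c]
      exact log_sum_le_sum_log _ _ hsubne fun c' hc' => R.two_le_card_fib_succ hc'
    have h2 : Nat.log 2 (R.fib k c).card ≤ Nat.log 2 (R.surv k c).card + ((R.fib k c).card - (R.surv k c).card) := by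
      have := log_add_le (card_pos.2 hne).ne' ((R.fib k c).card - (R.surv k c).card)
      rwa [Nat.add_sub_cancel' hsub] at this
    omega

/-- **Fat per-cell inequality.** If the cell of colour `c` contains two distinct cells of node `k+1`, both of
size `≥ d'`, the per-cell inequality improves by `⌊log₂ d'⌋ - 1`. -/
theorem log_fib_le_of_two {k c c₁ c₂ d' : ℕ} (hc₁ : c₁ ∈ R.sub k c) (hc₂ : c₂ ∈ R.sub k c)
    (hne : c₁ ≠ c₂) (hd₁ : d' ≤ (R.fib (k + 1) c₁).card) (hd₂ : d' ≤ (R.fib (k + 1) c₂).card) :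
    Nat.log 2 (R.fib k c).card + Nat.log 2 d' ≤
      ∑ c' ∈ R.sub k c, Nat.log 2 (R.fib (k + 1) c').card + ((R.fib k c).card - (R.surv k c).card) + 1 := by
  -- w.l.o.g. the fibre of `c₁` is the smaller of the two
  wlog hle : (R.fib (k + 1) c₁).card ≤ (R.fib (k + 1) c₂).card generalizing c₁ c₂
  · exact this hc₂ hc₁ hne.symm hd₂ hd₁ (le_of_not_ge hle)
  set f : ℕ → ℕ := fun c' => (R.fib (k + 1) c').card with hf
  have hsub : (R.surv k c).card ≤ (R.fib k c).card := card_le_card (R.surv_subset_fib k c)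
  have hsum : f c₁ + ∑ c' ∈ (R.sub k c).erase c₁, f c' = (R.surv k c).card := by
    rw [add_sum_erase _ _ hc₁]; exact R.sum_card_fib_succ k c
  have hT : ((R.sub k c).erase c₁).Nonempty := ⟨c₂, mem_erase.2 ⟨hne.symm, hc₂⟩⟩
  have hTge : f c₂ ≤ ∑ c' ∈ (R.sub k c).erase c₁, f c' :=
    single_le_sum (f := f) (fun _ _ => Nat.zero_le _) (mem_erase.2 ⟨hne.symm, hc₂⟩)
  -- superadditivity on the rest
  have h1 : Nat.log 2 (∑ c' ∈ (R.sub k c).erase c₁, f c') ≤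
      ∑ c' ∈ (R.sub k c).erase c₁, Nat.log 2 (f c') :=
    log_sum_le_sum_log _ _ hT fun c' hc' => R.two_le_card_fib_succ (mem_of_mem_erase hc')
  -- the rest is at least half of the surviving part
  have h2 : Nat.log 2 (R.surv k c).card ≤ Nat.log 2 (∑ c' ∈ (R.sub k c).erase c₁, f c') + 1 := by
    apply log_le_log_half_succ
    · have : 2 ≤ f c₂ := R.two_le_card_fib_succ hc₂
      omega
    · have : f c₁ ≤ f c₂ := hle
      omega
  have h3 : Nat.log 2 (R.fib k c).card ≤ Nat.log 2 (R.surv k c).card + ((R.fib k c).card - (R.surv k c).card) := by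
    have hne0 : (R.surv k c).card ≠ 0 := by
      have : 2 ≤ f c₂ := R.two_le_card_fib_succ hc₂
      omega
    have := log_add_le hne0 ((R.fib k c).card - (R.surv k c).card)
    rwa [Nat.add_sub_cancel' hsub] at this
  have h4 : Nat.log 2 d' ≤ Nat.log 2 (f c₁) := Nat.log_mono_right hd₁
  have h5 : ∑ c' ∈ R.sub k c, Nat.log 2 (R.fib (k + 1) c').card =
      Nat.log 2 (f c₁) + ∑ c' ∈ (R.sub k c).erase c₁, Nat.log 2 (f c') := by
    rw [add_sum_erase _ (fun c' => Nat.log 2 (f c')) hc₁]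
  omega

/-! ### The dichotomy and the transition inequality -/

/-- **Halved survivor.** At every transition `k → k+1` before the end some surviving vertex has its
cell at least halved: H3 cut at `S = W (k+1)` gives a switching-edge from a survivor `a` to a removed
vertex, which `not_swAdj_of_removed` forbids unless the cell of `a` at least halves. -/
theorem exists_halved_survivor {k : ℕ} (hk : k + 1 < N) :
    ∃ a ∈ R.W (k + 1), 2 * (R.cell (k + 1) a).card ≤ (R.cell k a).card := by
  have hk0 : k < N := Nat.lt_of_succ_lt hk
  obtain ⟨x, hx, hx'⟩ := R.exists_removed hk0
  obtain ⟨x', hx'1, -⟩ := R.exists_removed hk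
  have hS : R.W (k + 1) ⊆ R.W k := R.nest k
  have hSne : (R.W (k + 1)).Nonempty := ⟨x', hx'1⟩
  have hSneW : R.W (k + 1) ≠ R.W k := fun h => hx' (h ▸ hx)
  obtain ⟨a, ha, b, hb, hab⟩ := R.connected k _ hS hSne hSneW
  rw [mem_sdiff] at hb
  refine ⟨a, ha, not_lt.1 fun hgiant => ?_⟩
  exact R.not_swAdj_of_removed hb.1 hb.2 ha hgiant hab.symm

/-- The removed vertices counted cellwise. -/
theorem sum_card_fib_sub_surv (k : ℕ) :
    ∑ c ∈ R.colours k, ((R.fib k c).card - (R.surv k c).card) + (R.W (k + 1)).card = (R.W k).card := by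
  rw [← R.sum_card_surv k, ← sum_add_distrib, ← R.sum_card_fib k]
  exact sum_congr rfl fun c _ => Nat.sub_add_cancel (card_le_card (R.surv_subset_fib k c))

/-- **Transition inequality** (additive form): `⌊log₂ d_{k+1}⌋ + Φ_k + 2|W_{k+1}| ≤ Φ_{k+1} + 2|W_k| + 1`. -/
theorem log_d_succ_le {k : ℕ} (hk : k + 1 < N) :
    Nat.log 2 (R.d (k + 1)) + R.Phi k + 2 * (R.W (k + 1)).card ≤ R.Phi (k + 1) + 2 * (R.W k).card + 1 := by
  obtain ⟨a, ha, hhalf⟩ := R.exists_halved_survivor hk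
  have haW : a ∈ R.W k := R.nest k ha
  set c := R.col k a with hc
  set c₁ := R.col (k + 1) a with hc₁
  have hcC : c ∈ R.colours k := R.col_mem_colours haW
  have hc₁S : c₁ ∈ R.sub k c := R.col_succ_mem_sub ha
  have hδ := R.sum_card_fib_sub_surv k
  have hPhi := R.Phi_succ_eq k
  -- the general bound `Φ_k ≤ Φ_{k+1} + δ`, with the cell of `a` singled out
  have hrest : ∑ c' ∈ (R.colours k).erase c, Nat.log 2 (R.fib k c').card ≤
      ∑ c' ∈ (R.colours k).erase c, (∑ c'' ∈ R.sub k c', Nat.log 2 (R.fib (k + 1) c'').card +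
        ((R.fib k c').card - (R.surv k c').card)) :=
    sum_le_sum fun c' hc' => R.log_fib_le (mem_of_mem_erase hc')
  have hsplitPhi : R.Phi k = Nat.log 2 (R.fib k c).card + ∑ c' ∈ (R.colours k).erase c, Nat.log 2 (R.fib k c').card := by
    rw [Phi, ← add_sum_erase (R.colours k) (fun c' => Nat.log 2 (R.fib k c').card) hcC]
  have hsplit1 : ∑ c' ∈ R.colours k, ∑ c'' ∈ R.sub k c', Nat.log 2 (R.fib (k + 1) c'').card =
      ∑ c'' ∈ R.sub k c, Nat.log 2 (R.fib (k + 1) c'').card +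
        ∑ c' ∈ (R.colours k).erase c, ∑ c'' ∈ R.sub k c', Nat.log 2 (R.fib (k + 1) c'').card := by
    rw [← add_sum_erase (R.colours k) (fun c' => ∑ c'' ∈ R.sub k c', Nat.log 2 (R.fib (k + 1) c'').card) hcC]
  have hsplit2 : ∑ c' ∈ R.colours k, ((R.fib k c').card - (R.surv k c').card) =
      ((R.fib k c).card - (R.surv k c).card) +
        ∑ c' ∈ (R.colours k).erase c, ((R.fib k c').card - (R.surv k c').card) := by
    rw [← add_sum_erase (R.colours k) (fun c' => (R.fib k c').card - (R.surv k c').card) hcC]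
  rw [sum_add_distrib] at hrest
  have hd₁ : R.d (k + 1) ≤ (R.fib (k + 1) c₁).card := R.d_le (k + 1) a ha
  by_cases hfat : ∃ c₂ ∈ R.sub k c, c₂ ≠ c₁
  · -- FAT: the cell of `a` contains a second cell of node `k+1`
    obtain ⟨c₂, hc₂S, hne⟩ := hfat
    obtain ⟨u₂, hu₂, hu₂c⟩ := mem_image.1 hc₂S
    have hu₂W : u₂ ∈ R.W (k + 1) := (mem_filter.1 hu₂).1
    have hd₂ : R.d (k + 1) ≤ (R.fib (k + 1) c₂).card := hu₂c ▸ R.d_le (k + 1) u₂ hu₂W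
    have hcell := R.log_fib_le_of_two hc₁S hc₂S hne.symm hd₁ hd₂
    have hW : (R.W (k + 1)).card ≤ (R.W k).card := card_le_card (R.nest k)
    rw [hsplitPhi, hPhi, hsplit1]
    rw [hsplit2] at hδ
    omega
  · -- HEAVY: the cell of `a` keeps only the (halved) cell of `a`; at least `d_{k+1}` vertices leave it
    push Not at hfat
    have hsubeq : R.sub k c = {c₁} := eq_singleton_iff_unique_mem.2 ⟨hc₁S, hfat⟩
    have hsurv : (R.surv k c).card = (R.fib (k + 1) c₁).card := by
      rw [← R.sum_card_fib_succ k c, hsubeq, sum_singleton]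
    have hhalf' : 2 * (R.fib (k + 1) c₁).card ≤ (R.fib k c).card := hhalf
    have hcell := R.log_fib_le hcC
    have hlogd : Nat.log 2 (R.d (k + 1)) ≤ R.d (k + 1) := Nat.log_le_self 2 _
    have hterm : (R.fib k c).card - (R.surv k c).card ≤
        ∑ c' ∈ R.colours k, ((R.fib k c').card - (R.surv k c').card) :=
      single_le_sum (f := fun c' => (R.fib k c').card - (R.surv k c').card) (fun _ _ => Nat.zero_le _) hcC
    have hr : R.d (k + 1) ≤ (R.fib k c).card - (R.surv k c).card := by omega
    rw [hsplitPhi, hPhi, hsplit1]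
    rw [hsplit2] at hδ hterm
    omega

/-! ### Telescoping -/

/-- Each transition removes a vertex: `j + |W_j| ≤ |W_0|` for `j ≤ N`; in particular `N ≤ |W_0|`. -/
theorem add_card_W_le {j : ℕ} (hj : j ≤ N) : j + (R.W j).card ≤ (R.W 0).card := by
  induction j with
  | zero => simp
  | succ j ih =>
    have hjN : j < N := Nat.lt_of_succ_le hj
    have hss : R.W (j + 1) ⊂ R.W j := by
      refine (R.nest j).ssubset_of_ne (R.progress j hjN)
    have := card_lt_card hss
    have := ih hjN.le
    omega

/-- Telescoped transition inequalities. -/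
theorem sum_log_d_succ_le {n : ℕ} (hn : n + 1 ≤ N) :
    ∑ k ∈ range n, Nat.log 2 (R.d (k + 1)) + R.Phi 0 + 2 * (R.W n).card ≤ R.Phi n + 2 * (R.W 0).card + n := by
  induction n with
  | zero => simp
  | succ n ih =>
    have h1 := ih (Nat.le_of_succ_le hn)
    have h2 := R.log_d_succ_le (k := n) hn
    rw [sum_range_succ]
    omega

/-- **log-BranchSum (ANALYSIS-4 §8, Theorem G).** Along a refinement path the branching numbers satisfy
`Σ_{k<N} ⌊log₂ d_k⌋ ≤ 4·|V| + ⌊log₂ |V|⌋`. -/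
theorem sum_log_d_le [Fintype V] (R : RefinementPath G N) :
    ∑ k ∈ range N, Nat.log 2 (R.d k) ≤ 4 * Fintype.card V + Nat.log 2 (Fintype.card V) := by
  rcases Nat.eq_zero_or_pos N with hN | hN
  · subst hN; simp
  · obtain ⟨M, rfl⟩ : ∃ M, N = M + 1 := ⟨N - 1, by omega⟩
    rw [sum_range_succ']
    have h1 := R.sum_log_d_succ_le (n := M) le_rfl
    have h2 : R.Phi M ≤ Fintype.card V := (R.Phi_le_card M).trans (card_le_univ _)
    have h3 : (R.W 0).card ≤ Fintype.card V := card_le_univ _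
    have h4 := R.add_card_W_le (j := M + 1) le_rfl
    have h5 : Nat.log 2 (R.d 0) ≤ Nat.log 2 (Fintype.card V) := by
      obtain ⟨x, hx, -⟩ := R.exists_removed (k := 0) (by omega)
      exact Nat.log_mono_right ((R.d_le 0 x hx).trans (card_le_univ _))
    omega

end RefinementPath

end BranchSum

end Summit.PneNP.PneNP.Theorems
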